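import Summits.AtomisticToContinuum.HydrodynamicLimit.Theses.BoxDissipativeWeakStrong
import Summits.AtomisticToContinuum.HydrodynamicLimit.Theorems.BoxDissipativeWeakStrongDefs

/-!
# Crux `EntropyAdmissibility` (stmt-AtomisticToContinuum-9903), line `registered` —
# stub `stub_entropyModulus`

The deterministic statics stub S0a of the line `registered` of the crux
`Summit.AtomisticToContinuum.HydrodynamicLimit.Theses.BoxDissipativeWeakStrong.EntropyAdmissibility`
— a modulus of continuity of the clamped cut entropy
`G(q) = Z_{a,b}(s_cut(q.1, θ̂(q)))`, `q = (r, m, e) ∈ ℝ × ℝ³ × ℝ`, UNIFORM over base points `p` in a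
compact set `K` of physical band states (`0 < r`, `r σ³ < η₁`, `0 < θ̂`), assuming only that the
excess free energy `f_ex` is continuous on `[0, η₀)` with `η₁ < η₀`.

Proof. `G` is continuous AT every point `p` of the band: `θ̂(q) = ⅔(e/r − ‖m‖²/(2r²))` is continuous
off `r = 0`, `log θ̂` and `log r` are continuous where their arguments are positive,
`q ↦ f_ex(min (rσ³) η₁)` is continuous at `p` because `min (p.1 σ³) η₁ ∈ (0, η₀)` is an interior
point of `[0, η₀)`, `q ↦ log (max (rσ³) η₁ / η₁)` is continuous (argument `≥ 1`), and the clamp is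
continuous (`CompressibleEuler.continuous_clamp`). Compactness of `K` then gives uniform continuity
AT the set `K` (`IsCompact.uniformContinuousAt_of_continuousAt`: `G q` is close to `G p` whenever
`p ∈ K` and `q` is close to `p`, even for `q ∉ K`), which is unpacked metrically
(`Metric.mem_uniformity_dist`). Mathlib only; no measure theory.

References: J. Březina, E. Feireisl, *Measure-valued solutions to the complete Euler system*,
J. Math. Soc. Japan 70 (2018), §3.2 (the clamps `Z_{a,b}`).
-/

noncomputable section

open MeasureTheory Filter Set
open scoped ENNReal Topology


namespace Summit.AtomisticToContinuum.HydrodynamicLimit.Theorems.EABirthS0a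

open Literature.MathematicalPhysics.KineticTheory
open Literature.Analysis.FluidPDE.CompressibleEuler (clamp)
open Summit.AtomisticToContinuum.HydrodynamicLimit.Theses
open Summit.AtomisticToContinuum.HydrodynamicLimit.Theorems.BDWS

/-- The box temperature `q = (r, m, e) ↦ θ̂(r, m, e) = ⅔(e/r − ‖m‖²/(2r²))` is continuous at every
point with `r ≠ 0`. -/
theorem continuousAt_boxTemp {p : ℝ × V3 × ℝ} (hp : p.1 ≠ 0) :
    ContinuousAt (fun q : ℝ × V3 × ℝ => boxTemp q.1 q.2.1 q.2.2) p := by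
  have h2 : (2 : ℝ) * p.1 ^ 2 ≠ 0 := by positivity
  unfold boxTemp
  fun_prop (disch := assumption)

/-- Continuity of the clamped cut entropy `q ↦ Z_{a,b}(s_cut(q.1, θ̂(q)))` at every point of the
physical band `0 < r`, `0 < θ̂` below the cut (`f_ex` continuous on `[0, η₀)`, `0 < η₁ < η₀`). -/
theorem continuousAt_clamp_cutEntropy {η₀ σ η₁ : ℝ}
    (hcont : ContinuousOn hsExcessFreeEnergy (Ico 0 η₀)) (hσ : 0 < σ) (hη₁ : 0 < η₁)
    (hη₁₀ : η₁ < η₀) (a b : ℝ) {p : ℝ × V3 × ℝ} (hp : 0 < p.1)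
    (hθ : 0 < boxTemp p.1 p.2.1 p.2.2) :
    ContinuousAt
      (fun q : ℝ × V3 × ℝ => clamp a b (cutEntropy σ η₁ q.1 (boxTemp q.1 q.2.1 q.2.2))) p := by
  -- the two logarithms, off their singular sets
  have hlogT : ContinuousAt (fun q : ℝ × V3 × ℝ => Real.log (boxTemp q.1 q.2.1 q.2.2)) p :=
    (continuousAt_boxTemp hp.ne').log hθ.ne'
  have hlogr : ContinuousAt (fun q : ℝ × V3 × ℝ => Real.log q.1) p :=
    continuousAt_fst.log hp.ne'
  -- the excess free energy at `min (r σ³) η₁ ∈ (0, η₀)`, an interior point of `[0, η₀)`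
  have hF : ContinuousAt
      (fun q : ℝ × V3 × ℝ => hsExcessFreeEnergy (min (q.1 * σ ^ 3) η₁)) p := by
    have hm : Continuous (fun q : ℝ × V3 × ℝ => min (q.1 * σ ^ 3) η₁) := by fun_prop
    have h0 : 0 < min (p.1 * σ ^ 3) η₁ := lt_min (by positivity) hη₁
    have h1 : min (p.1 * σ ^ 3) η₁ < η₀ := lt_of_le_of_lt (min_le_right _ _) hη₁₀
    have hf : ContinuousAt hsExcessFreeEnergy (min (p.1 * σ ^ 3) η₁) :=
      hcont.continuousAt (Ico_mem_nhds h0 h1)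
    exact ContinuousAt.comp' (g := hsExcessFreeEnergy)
      (f := fun q : ℝ × V3 × ℝ => min (q.1 * σ ^ 3) η₁) (x := p) hf hm.continuousAt
  -- the logarithmic tail, argument `≥ 1`
  have hL : ContinuousAt
      (fun q : ℝ × V3 × ℝ => Real.log (max (q.1 * σ ^ 3) η₁ / η₁)) p := by
    have hm : Continuous (fun q : ℝ × V3 × ℝ => max (q.1 * σ ^ 3) η₁ / η₁) := by fun_prop
    exact hm.continuousAt.log (div_pos (lt_of_lt_of_le hη₁ (le_max_right _ _)) hη₁).ne'
  have hS : ContinuousAt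
      (fun q : ℝ × V3 × ℝ => cutEntropy σ η₁ q.1 (boxTemp q.1 q.2.1 q.2.2)) p := by
    simp only [cutEntropy, cutExcessFreeEnergy]
    exact ((continuousAt_const.mul hlogT).sub hlogr).sub (hF.add (continuousAt_const.mul hL))
  exact (Literature.Analysis.FluidPDE.CompressibleEuler.continuous_clamp a b).continuousAt.comp' hS

/-- **Signature of S0a** (byte copy of `Sig.stub_entropyModulus` of the lead's skeleton): if the
excess free energy is continuous on `[0, η₀)`, then for `0 < σ`, `0 < η₁ < η₀`, reals `a, b` and
every compact set `K` of states `p = (r, m, e)` in the physical band (`0 < r`, `r σ³ < η₁`,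
`0 < θ̂(p)`), the map `G(q) = Z_{a,b}(s_cut(q.1, θ̂(q)))` has a modulus of continuity uniform over
base points in `K`: `∀ ε > 0 ∃ δ > 0 ∀ p ∈ K ∀ q, dist q p < δ → |G q − G p| < ε`. -/
def Sig.stub_entropyModulus : Prop :=
  ∀ η₀ : ℝ, 0 < η₀ → ContinuousOn hsExcessFreeEnergy (Ico 0 η₀) →
    ∀ (σ η₁ a b : ℝ), 0 < σ → 0 < η₁ → η₁ < η₀ →
      ∀ K : Set (ℝ × V3 × ℝ), IsCompact K →
        (∀ p ∈ K, 0 < p.1 ∧ p.1 * σ ^ 3 < η₁ ∧ 0 < boxTemp p.1 p.2.1 p.2.2) →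
        ∀ ε : ℝ, 0 < ε → ∃ δ : ℝ, 0 < δ ∧ ∀ p ∈ K, ∀ q : ℝ × V3 × ℝ, dist q p < δ →
          |clamp a b (cutEntropy σ η₁ q.1 (boxTemp q.1 q.2.1 q.2.2)) -
              clamp a b (cutEntropy σ η₁ p.1 (boxTemp p.1 p.2.1 p.2.2))| < ε

/-- **S0a — modulus of continuity of the clamped cut entropy**, uniform over base points in a
compact set of physical band states: continuity of `G` at each point of `K`
(`continuousAt_clamp_cutEntropy`) and compactness of `K`
(`IsCompact.uniformContinuousAt_of_continuousAt`, unpacked with `Metric.mem_uniformity_dist`). -/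
theorem stub_entropyModulus : Sig.stub_entropyModulus := by
  intro η₀ _hη₀ hcont σ η₁ a b hσ hη₁ hη₁₀ K hK hKV ε hε
  have hGat : ∀ p ∈ K, ContinuousAt
      (fun q : ℝ × V3 × ℝ => clamp a b (cutEntropy σ η₁ q.1 (boxTemp q.1 q.2.1 q.2.2))) p :=
    fun p hp => continuousAt_clamp_cutEntropy hcont hσ hη₁ hη₁₀ a b (hKV p hp).1 (hKV p hp).2.2
  obtain ⟨δ, hδ, hδU⟩ := Metric.mem_uniformity_dist.1
    (hK.uniformContinuousAt_of_continuousAt _ hGat (Metric.dist_mem_uniformity hε))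
  refine ⟨δ, hδ, fun p hp q hq => ?_⟩
  have h : dist (clamp a b (cutEntropy σ η₁ p.1 (boxTemp p.1 p.2.1 p.2.2)))
      (clamp a b (cutEntropy σ η₁ q.1 (boxTemp q.1 q.2.1 q.2.2))) < ε :=
    hδU (by rwa [dist_comm] at hq) hp
  rwa [Real.dist_eq, abs_sub_comm] at h

end Summit.AtomisticToContinuum.HydrodynamicLimit.Theorems.EABirthS0a

end
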